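import Mathlib
import HarnessLib
import HarnessLib.Audit
import Summits.PneNP.Statement
import Literature.Computability.Complexity.Classes
import Literature.Computability.Complexity.Nondeterministic
import Literature.Computability.Complexity.CookBridges
import Literature.Computability.Complexity.UniformCircuitClasses
import Literature.Computability.MetaComplexity.AtseriasMuller2025.UniformMagnification
import Literature.Computability.MetaComplexity.FarFromSparseJuntaBounds

/-!
Route: RootDecompParityMagnification

DORMANT since 2026-09-04T15:04:37Z (reconciler: no traction for 5 d (last activity statement-checked at 2026-08-30T13:50:24Z); parked, not closed — `ledger route dormant route-PneNP-RootDecompParityMagnification --off` to reactivate) — unstaffed, not closed; items shared with open routes are served there. `ledger route dormant <id> --off` reactivates.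

Root-decomposition cell decomp-pnenp (D-0178), node N30 = proposal P30 (lens-1 gen 8
«RootDecompParityMagnification — magnification BELOW the summit»,
HOME/decomp-pnenp-lens-1/ParityMagnification.lean sha256 15429395,
HOME/decomp-pnenp-lens-1/NODE-g8.md sha256 9853da16; critic decomp-pnenp-crit-1 g4 CLEARED
2026-08-30T07:42:33Z with 0 blocking objections, scores once under cap (vii); thin route ADMISSIBLE
— built modules only, no vendored copies). It suffices to show X = A ∧ R, the law-D cut of S = PneNP
along the cut predicate Y := CellLB(1/100) = «the N^{0.99}-approximate MCSP[2^{⌊√ℓ⌋+1}] promise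
problem Q has no P-uniform B₂-circuits of size ⌈N^{1.02}⌉» (Atserias–Müller 2025's uniform
magnification hypothesis `HypothesisU (1/100) (1/100) slowScale`, census row R13's coordinate, ONE
cell in zone Z3): A = ShadowAM := ¬S → Y (crux r2, ATTACKED) and R = LiftAM := Y → S (crux r3,
DECLARED RESIDUAL). S ↔ A ∧ R hypothesis-free (writer `pneNP_iff`, lens `node_iff`). What makes the
cell worth a node: the print lift of Y lands STRICTLY BELOW the summit — AM25 Thm 11 gives Y → W
with W := P ≠ NP^{⊕P}, and W ↔ S ∨ (P ≠ ⊕P) IN KERNEL (lens `pneNPParityP_iff`), so R = N10's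
residual ParityLift RESTRICTED to the LB worlds (lens `liftAM_iff`, mod thm11) and A sits above
N10's ParityTransfer (lens `parityTransfer_of_shadowAM`). Two asides bank the decided context:
SublinearRungAM (zone Z1, TRUE in tree — BC5 witness) and UniformClassInhabitedAM (vacuity guard,
TRUE — critic kernel). No card realised (cell node).
Lean: (¬ PneNP → Literature.Computability.MetaComplexity.AtseriasMuller2025.HypothesisU (1 / 100 :
ℝ) (1 / 100 : ℝ) (fun ℓ => 2 ^ (Nat.sqrt ℓ + 1))) ∧
(Literature.Computability.MetaComplexity.AtseriasMuller2025.HypothesisU (1 / 100 : ℝ) (1 / 100 : ℝ)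
(fun ℓ => 2 ^ (Nat.sqrt ℓ + 1)) → PneNP)

Rationale: WHY THIS LINE. Hardness magnification rows normally lift a barely-superlinear lower bound for a
sparse meta-problem TO the summit or beyond it (P21 SparsityDial: CHMY one-tape DTIME₁[N^{1.01}] →
S; N11 McspDial; hub UniformStream = MMW Thm 1.1, summit-hard by `pneNP_of_uniformStreamLB`; N16
Kt-perebor; non-uniform rows → NP ⊄ NC¹ / NP ⊄ P/poly, no root node). Atserias–Müller 2025
(arXiv:2503.24061) Thm 11 / Thm 27 is the one row whose conclusion is STRICTLY WEAKER than S and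
comparable with it: `n^{−ε}-MCSP[σ] ∉ P-uniform-SIZE[n^{1+ε+δ}] ⟹ P ≠ NP^{⊕P}`, typed in the tree
(`AtseriasMuller2025.UniformMagnification`: HypothesisU, thm27, thm11, `thm11_of_thm27` proved) with
its KNOWN side (`FarFromSparseJuntaBounds.apxMCSP_not_mem_PUniformSIZE_sublinear`, census
`gap_R13_known`). Cutting S along Y = HypothesisU at ONE cell (ε = δ = 1/100, σ = 2^{⌊√ℓ⌋+1})
therefore MOVES WEIGHT out of N10's structural residual «Algorithmica counts mod 2»
(route-PneNP-RootDecompParityCell, ParityLift 27750 → 30229) into a CONCRETE P-uniform circuit lower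
bound for one fixed sparse promise problem — in kernel, mod the single print fact thm11: A ⟹
ParityTransfer (27751 side), ParityLift ⟹ R, R ⟺ (Y → ParityLift), (¬S → W) ⟺ ParityTransfer
hypothesis-free. What is imported: from meta-complexity the magnification theorem (AM25 Thm 11/27)
and the junta/light-cone lower bound deciding zone Z1; from structural complexity the relativized ⊕P
worlds that price R (Beigel–Maciel 1999: P = NP, ⊕P = EXP; TQBF); from uniform circuit complexity
the anchor technique for A (Santhanam–Williams 2014, indirect diagonalization: `∀c ∃L ∈ P, L ∉
P-uniform-SIZE[n^c]` — AM p.3 «almost known», but ∀c∃L vs the fixed L = Q: census R13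
THRESHOLD-ONLY). The dial (law D, one problem, one class, one parameter = the size budget t of
PUniformSIZE t; antitone `lbAt_anti`) has three zones each decided BY A THEOREM (lens
`phase_summary`): Z1 t = N − ⌈N^θ⌉ TRUE in tree (shadow proved, residual ≡ S — costume cell located
by theorem; aside SublinearRungAM); Z2 N ≤ t ≤ N^{1.01} knife zone; Z3 t = ⌈N^{1.01+δ}⌉, δ > 0,
print lift to W only — NO closure of the dial reaches S (`closure_lifts_to_W`), which is exactly why
R keeps ParityLift-content instead of collapsing to S.
RANKED CRUXES. #2 ShadowAM (attacked; IDEA-NEEDED problem-specific uniform LB; S-inert with expected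
side) ≻ #3 LiftAM (declared residual; below N10's residual of record mod thm11; strictness vs
ParityLift undecided, test T_BM; no residual score claimed). Asides (never staffed, banked):
SublinearRungAM (Z1, proved), UniformClassInhabitedAM (vacuity guard, proved). thm11 is a binder of
EDGES only — not an item, not in closes.
KILL CRITERIA. A refuted ⟺ someone exhibits P-uniform ⌈N^{1.02}⌉-size circuits for Q assuming only P
= NP-compatible means — practically: the route is retired `not-a-thesis` if the tribunal rules Y
summit-strength (it is not: C→S probes fail, Y is implied by neither S nor ¬S), `superseded` if
CellLB(1/100) is PROVED outright (then W = P ≠ NP^{⊕P} outright, R ≡ S fires as pre-costume and the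
node collapses to the summit), or closed `refuted:LiftAM` if a world with Y ∧ P = NP is certified
against the tree semantics (T_BM decided negatively in kernel).
NOT DECOMPOSED YET. R (residual) — no decomposition offered (it is N10's R on LB worlds; any split
belongs to the ⊕P column). A — the foreseen glued split (tenure, not now) is along AM's own open
question p.3 L54–56 («a general uniform magnification threshold for any 2^{n^{o(1)}}-sparse
problem?»): A ⟸ «∀c, Q ∉ P-uniform-SIZE[n^c] in Algorithmica» ⟸ a Santhanam–Williams-type win-win
FOR THE FIXED PROBLEM Q; not typed until a prover proposes the first rung above Z1 (budget N, zone
Z2).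
CHEAPEST FALSIFIER. `#h21_crux_probe` on A and R against PneNP (run by lens, critic and writer: both
CLEAN, C→S fails, S→C informational); the literature check that no P-uniform super-linear size lower
bound is known for apx-MCSP or any fixed sparse NP promise problem (AM25 p.3; census R13: none) —
were one in print at budget ≥ N^{1.02}, A would be a theorem and R ≡ S (costume), killing the node
as a decomposition.

Novelty: Searches RUN (lens g8 + critic + writer): `lean search 'HypothesisU'`, `lean search 'PUniformSIZE'`,
`lean search 'PneNPParityP'` (tree: AM25 module + census only; no Theses route typed over
HypothesisU before this one — N11 McspDial cuts along reduction strength, N16 along the non-uniform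
Kt-perebor exponent, P21 along CHMY one-tape time, hub UniformStream along MMW streaming space:
different levers, all lifting TO S); `ledger negatives --problem PneNP` (no statement over
AtseriasMuller2025.*); lit: [corpus:paper:arxiv-2503.24061 p0005 L42–56] (Thm 11 + «almost known» +
locality sidestep + open question), [graph:doi:10.1007/s00037-014-0087-y] (Santhanam–Williams 2014,
not held), [corpus:paper:arxiv-2111.10409 p.33] (Beigel–Maciel world), galaxy `"uniform
magnification|P-uniform circuits|NP with parity oracle"` --star all (lens g8: no hit placing a
fixed-problem P-uniform N^{1+ε} bound in print). NEAREST PRIOR ART: AM25 itself (the cut predicate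
and the lift are theirs; the ROOT DECOMPOSITION — S ⟺ (¬S → Y) ∧ (Y → S) with the residual
identified in kernel as N10's ParityLift on LB worlds — is the cell's); nearest cell routes N10
RootDecompParityCell (residual column) and P21/N11 (magnification TO S). DELTA in one sentence: the
first magnification node whose print lift pays STRICTLY BELOW the summit (W ⟺ S ∨ P ≠ ⊕P in kernel),
so the magnification axis MEETS the counting cell — A ≥ ParityTransfer, R ≤ ParityLift mod thm11 —
instead of restating S. Claimed grade (cell-relative)  [refs: 10.1007/s00037-014-0087-y, paper:arxiv-2503.24061, doi:10.1007/s00037-014-0087-y, paper:arxiv-2111.10409, AtseriasMuller2025]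

Barriers (technique_class: uniform-circuit-LB, hardness-magnification, law-D-carving): - technique_class: uniform-circuit-lower-bounds, indirect-diagonalization, hardness-magnification,
law-D-carving
- Literature.Barriers.PneNP.Relativization (BGS75): A — INSIDE unless the eventual proof of CellLB
is non-relativizing w.r.t. oracle gates: relative to TQBF everything collapses (P = NP^{⊕P} =
PSPACE) so W fails and, IF Thm 27's proof relativizes with oracle gates (uniform simulation +
PH-oracle seed search — plausible, UNVERIFIED, lens flag), CellLB^TQBF is false; the anchor
technique SW13 is diagonalization-based (relativization status not checked — flag). R — relativized
both ways via N10 (BM99 kills ParityLift, TQBF verifies it), restricted to LB worlds; the bet is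
that R is residual (declared), not attacked.
- Literature.Barriers.PneNP.NaturalProofs (RR97): A — OUTSIDE in form: the class is P-UNIFORM and
the only known road (Santhanam–Williams) is indirect diagonalization / win-win, not a constructive
large property; the uniformity conjunct is load-bearing for the evasion (the NON-uniform analogue
SIZE[N^{1.02}] for Q would be RR-relevant: linear-size PRF candidates). R — not a lower-bound
statement; n/a.
- Literature.Barriers.PneNP.Algebrization (AW09): A — same status as relativization (flag:
unverified whether Thm 27 algebrizes); R — inherits N10's pricing.
- Literature.Barriers.PneNP.Locality (CHOPRS20): A — OUTSIDE: the catalogued barrier quantifies over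
NON-UNIFORM local circuit classes (census header §B) and does not cover census row R13;
Atserias–Mülle

History (route lifecycle, newest last):
- 2026-09-04T15:04:37Z · DORMANT — reconciler: no traction for 5 d (last activity statement-checked at 2026-08-30T13:50:24Z); parked, not closed — `ledger route dormant route-PneNP-RootDecompPari (operator:999:2025762)

sub-problem: PneNP · status: dormant · opened planner-decomp-pnenp-writer-1-g5-0 2026-08-30T08:31:24Z · rev 0 · ledger route-PneNP-RootDecompParityMagnification
GENERATED by the gate from the ledger (D-0016/17). Provers cite these decls: `theorem foo : Summit.PneNP.PneNP.Theses.RootDecompParityMagnification.<Decl> := …` in Summits/PneNP/PneNP/Theorems/<Name>.lean.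
-/

namespace Summit.PneNP.PneNP.Theses.RootDecompParityMagnification

open scoped BigOperators Topology Manifold Classical MeasureTheory ProbabilityTheory Matrix InnerProductSpace ComplexConjugate ContinuousMap
open Filter Set Function TopologicalSpace MeasureTheory

attribute [summit_statement] _root_.PneNP

open Literature.PNP

/-- item stmt-PneNP-31121 · crux · rank 2 · open · by planner
why it might fail: False iff P = NP and Q ∈ P-uniform-SIZE[⌈N^{1.02}⌉]; no print or relativized evidence either way for this fixed problem (census R13 THRESHOLD-ONLY); AM25 Thm 27 makes CellLB FALSE in every P = NP^{⊕P} world (e.g. rel. TQBF).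
sources: arXiv:2503.24061 (Atserias–Müller 2025, Thm 11, Thm 27, p.3 L42–56), doi:10.1007/s00037-014-0087-y (Santhanam–Williams 2014), tree Literature/Computability/MetaComplexity/MagnificationGapCensus/PUniformCircuits.lean (census R13), HOME/decomp-pnenp-lens-1/ParityMagnification.lean sha256 15429395, HOME/critic/L1_ParityMagnification_g8_probe.lean sha256 3d14a880
[crux] PIECE A (ATTACKED) «in Algorithmica the N^{0.99}-approximate MCSP[2^{⌊√ℓ⌋+1}] promise problem
Q (YES = truth tables of B₂-size ≤ 2^{⌊√ℓ⌋+1}, NO = N^{0.99}-far from size ≤ 4·2^{⌊√ℓ⌋+1}+4) has no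
P-uniform (E-DC-uniform) B₂-circuits of size ⌈N^{1.02}⌉»: ¬PneNP → AtseriasMuller2025.HypothesisU
(1/100) (1/100) slowScale — the law-D shadow of S along the cut predicate Y = CellLB(1/100) =
Atserias–Müller 2025's uniform magnification hypothesis at ONE cell (ε = δ₀ = 1/100, zone Z3 where
Thm 11 applies and pays W := P ≠ NP^{⊕P}, STRICTLY BELOW S in kernel: lens `pneNPParityP_iff : W ↔
PneNP ∨ ParityShadow`). TAGS (D-0170/0171; critic CLEARED 2026-08-30T07:42:33Z; census v10 702f26e9
row NPM): WEAKER than S (formal, vacuous: `shadowAM_of_pneNP`) · NECESSARY (`pneNP_iff : S ↔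
ShadowAM ∧ LiftAM`, writer certificate) · not COSTUME (ShadowAM ⟹ S would need LiftAM = N10's
ParityLift on the LB worlds, open and relativized both ways BM99/TQBF; Y implied by neither S nor ¬S
— AM Thm 27 gives only ¬W ⟹ ¬Y) · UNDECIDED — tests T_LB (prove CellLB(1/100) outright ⇒ W outright
via thm11; open), T_U vacuity guard DISCHARGED in kernel (aside UniformClassInhabitedAM, critic
§CriticL1g8 / writer `uni -/
@[route_item "route-PneNP-RootDecompParityMagnification"]
def ShadowAM : Prop :=
  ¬ PneNP → Literature.Computability.MetaComplexity.AtseriasMuller2025.HypothesisU (1 / 100 : ℝ) (1 / 100 : ℝ) (fun ℓ => 2 ^ (Nat.sqrt ℓ + 1))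

/-- item stmt-PneNP-31122 · crux · rank 3 · open · by planner
why it might fail: False iff CellLB(1/100) holds in a world with P = NP (mod thm11: with P = NP ≠ ⊕P, e.g. Beigel–Maciel 1999); the status of apx-MCSP^A in near-linear P^A-uniform size there is not in print — undecided, expected to carry most of S.
sources: arXiv:2503.24061 (Atserias–Müller 2025, Thm 11), arXiv:2111.10409 p.33 (Beigel–Maciel 1999 world), BeigelMaciel1999, tree Summits/PneNP/PneNP/Theses/RootDecompParityCell.lean (ParityLift 27750 / ParityDichotomy 30229), HOME/decomp-pnenp-lens-1/ParityMagnification.lean sha256 15429395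
[crux] PIECE R (DECLARED RESIDUAL — carries S; tribunal_fit.residual) «a P-uniform ⌈N^{1.02}⌉ lower
bound for Q already separates P from NP»: AtseriasMuller2025.HypothesisU (1/100) (1/100) slowScale →
PneNP. TAGS (critic CLEARED 2026-08-30T07:42:33Z; census v10 row NPM): WEAKER than S (formal:
`liftAM_of_pneNP`) · NECESSARY (`pneNP_iff`) · not COSTUME (writer `liftAM_imp_pneNP_iff : (LiftAM →
S) ↔ S ∨ CellLB(1/100)` — LiftAM ⟹ S is exactly test T_LB, the cell lower bound outright, open) · IN
KERNEL BELOW N10's residual of record mod thm11: lens `liftAM_of_parityLift : thm11 → ParityLift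
(stmt-PneNP-27750 lineage, now 30229 ParityDichotomy after the 07:31:18Z split) → LiftAM`, exact
form `liftAM_iff : thm11 → (LiftAM ↔ (CellLB(1/100) → ParityLift))` — the residual IS «Algorithmica
counts mod 2» RESTRICTED to the worlds where the cell LB holds · strictness of the edge ParityLift ⟹
LiftAM UNDECIDED (test T_BM: in the Beigel–Maciel 1999 world P = NP, ⊕P = EXP
[corpus:paper:arxiv-2111.10409 p.33] ParityLift fails; whether Q^A ∈ P^A-uniform-SIZE^A[N^{1.02}]
there is not in print — AM's construction needs P = NP^{⊕P}) ⇒ NO residual score claimed, edge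
booked on N10's ⊕P column · PRE-COSTU -/
@[route_item "route-PneNP-RootDecompParityMagnification"]
def LiftAM : Prop :=
  Literature.Computability.MetaComplexity.AtseriasMuller2025.HypothesisU (1 / 100 : ℝ) (1 / 100 : ℝ) (fun ℓ => 2 ^ (Nat.sqrt ℓ + 1)) → PneNP

/-- item stmt-PneNP-31123 · aside · rank 9 · closed · proved by Summit.PneNP.PneNP.Theorems.sublinearRungAM_proof (prover) · by planner
why it might fail: n/a — proved (writer sublinearRungAM_holds from the tree theorem apxMCSP_not_mem_PUniformSIZE_sublinear).
sources: tree Literature/Computability/MetaComplexity/FarFromSparseJuntaBounds.lean (apxMCSP_not_mem_PUniformSIZE_sublinear), arXiv:2503.24061, writer folder/n30_paritymag/N30_items.lean sha256 474e9982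
[aside — DECIDED BOTTOM RUNG of the dial (zone Z1), BC5 witness, banked context; TRUE in tree] «Q ∉
P-uniform-SIZE[N − ⌈N^{0.995}⌉]»: the same cut-predicate family LBAt t := Q ∉ PUniformSIZE t at the
sub-linear budget t(N) = N − ⌈N^θ⌉, θ = 199/200 — PROVED (writer `sublinearRungAM_holds` = tree
`AtseriasMuller2025.apxMCSP_not_mem_PUniformSIZE_sublinear` + `subexpParam_slowScale`; lens
`sublinear_rung`; census `gap_R13_known`: Hamming-ball / light-cone counting, uniformity unused).
Role: the shadow family has a DECIDED rung in a regime where S is open (the residual there is ≡ S: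
lens `liftT_sublinear_iff_summit`, a COSTUME cell located by a theorem); it is the
tribunal_fit.witness of the route and exercises the lever (same problem Q, same class, smaller
budget). The dial: Z1 t = N − N^θ decided TRUE; Z2 N ≤ t ≤ N^{1.01} knife zone (nothing decided, no
print lift); Z3 t = ⌈N^{1.01+δ}⌉, δ > 0 lifts to W only (lens `closure_lifts_to_W`: NO closure of
this dial reaches S — contrast P21 `forallShadow_iff_summit`). Method ceiling in tree: the
light-cone method stops at n − ⌈n^{1−ε}⌉ + 1 (FarFromSparseJuntaBounds §ceiling). PROVENANCE: lens-1
g8 NODE «RootDecompParityMagnification — magnif -/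
@[route_item "route-PneNP-RootDecompParityMagnification"]
def SublinearRungAM : Prop :=
  Literature.Computability.MetaComplexity.AtseriasMuller2025.apxMCSP (Literature.Computability.MetaComplexity.AtseriasMuller2025.gapParam (1 / 100 : ℝ)) (fun ℓ => 2 ^ (Nat.sqrt ℓ + 1)) (Literature.Computability.MetaComplexity.AtseriasMuller2025.noSlack (fun ℓ => 2 ^ (Nat.sqrt ℓ + 1))) ∉ Literature.Computability.MetaComplexity.AtseriasMuller2025.PUniformSIZE (fun N => N - ⌈(N : ℝ) ^ (199 / 200 : ℝ)⌉₊)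

-- `SublinearRungAM` holds: proved by `Summit.PneNP.PneNP.Theorems.sublinearRungAM_proof` (its module imports this route file, so no `_holds` link can be stated here).

/-- item stmt-PneNP-31124 · aside · rank 9 · closed · proved by Summit.PneNP.PneNP.Theorems.uniformClassInhabitedAM_proof (prover) · by planner
why it might fail: n/a — proved (critic CriticL1g8.head_mem_PUniformSIZE_thresholdU; writer uniformClassInhabitedAM_holds).
sources: tree Literature/Computability/Complexity/UniformCircuitClassesWiresInhabited.lean (headFamily_isDLogTimeUniform), HOME/critic/L1_ParityMagnification_g8_probe.lean sha256 3d14a880, writer folder/n30_paritymag/N30_items.lean sha256 474e9982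
[aside — VACUITY GUARD, banked context; TRUE, proved by the critic in kernel] «the typed class
P-uniform-SIZE[⌈N^{1.02}⌉] is inhabited»: the HEAD promise problem ⟨HeadLang, HeadLangᶜ⟩ is decided
by the tree's DLOGTIME-uniform one-gate family headFamily (UniformCircuitClassesWiresInhabited.lean
`headFamily_isDLogTimeUniform`, landed 2026-08-30 03:07Z) of size 1 ≤ ⌈N^{1.02}⌉, DTIME(n) ⊆ E,
fan-in min n 1 ≤ 2 (B₂) — critic §CriticL1g8 `head_mem_PUniformSIZE_thresholdU`, re-proved verbatim
in the writer pack (`uniformClassInhabitedAM_holds`). Discharges the census's standing caveat hU for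
this node (test T_U): CellLB(1/100) is NOT true for want of uniform families, so the node does not
degenerate to LiftAM ⟺ S. (The lens's own guard — the constant-0 family for ⟨∅, univ⟩ — stays
unproved and is superseded by this one.) PROVENANCE: lens-1 g8 NODE «RootDecompParityMagnification —
magnification BELOW the summit» (HOME/decomp-pnenp-lens-1/ParityMagnification.lean sha256 15429395,
HOME/decomp-pnenp-lens-1/NODE-g8.md sha256 9853da16); critic decomp-pnenp-crit-1 g4 NODE-VERDICT
2026-08-30T07:42:33Z CLEARED (0 blocking objections; scores once under cap (vii) for the coordinate
«P-uniform size b -/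
@[route_item "route-PneNP-RootDecompParityMagnification"]
def UniformClassInhabitedAM : Prop :=
  (⟨Literature.Computability.Complexity.HeadLang, Literature.Computability.Complexity.HeadLangᶜ⟩ : Literature.Computability.Complexity.PromiseProblem) ∈ Literature.Computability.MetaComplexity.AtseriasMuller2025.PUniformSIZE (Literature.Computability.MetaComplexity.AtseriasMuller2025.thresholdU (1 / 100 : ℝ) (1 / 100 : ℝ))

-- `UniformClassInhabitedAM` holds: proved by `Summit.PneNP.PneNP.Theorems.uniformClassInhabitedAM_proof` (its module imports this route file, so no `_holds` link can be stated here).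

/-- item stmt-PneNP-31125 · assembly · rank 1 · open · by planner
why it might fail: n/a — proved (glue.lean closes).
sources: HOME/decomp-pnenp-lens-1/ParityMagnification.lean sha256 15429395, writer folder/n30_paritymag/N30_items.lean sha256 474e9982
[assembly] ShadowAM → LiftAM → PneNP: two lines of logic (by_contra; glue.lean `closes`, writer
`assembly_holds`); exactness `pneNP_iff : PneNP ↔ ShadowAM ∧ LiftAM` hypothesis-free (lens
`node_iff`, generic `cut_iff Y`, graded `cut_iff_at δ`). [difficulty: S] -/
@[route_item "route-PneNP-RootDecompParityMagnification"]
def Assembly : Prop :=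
  ShadowAM → LiftAM → PneNP

/-! D-0027 §2.1 — DECIDING THEOREM (planner-authored via `route open/edit --closes-file`; by planner-decomp-pnenp-writer-1-g5-0 2026-08-30T08:31:24Z):
its hypotheses are this route's items and its conclusion the sub-problem Statement (glue_lint), and it elaborates with this file. -/

@[closes "route-PneNP-RootDecompParityMagnification"] theorem closes (h₁ : ShadowAM) (h₂ : LiftAM) : _root_.PneNP := by
  by_contra hS
  exact hS (h₂ (h₁ hS))

end Summit.PneNP.PneNP.Theses.RootDecompParityMagnification
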